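import Summits.MatrixMultiplication.MatrixMultiplication.Theorems.SaturationLadderExpSaturationEntropy

/-!
# The two-parameter X-perfect `CW_q` family (route `SaturationLadder`, lens 1, gen 18) — file 1/2: layers B1, B2

Decomposition cell `decomp-mm`, lens 1 (grading / quantitative ladder), generation 18.  The lineage's
one-parameter family `(q, k, c)`, `qk = k + 1 + c`
(`Theorems/SaturationLadderExpSaturation*.lean`, joint type `(m(k+1), mk, mc, mk)`) is the diagonal `a = b + 1`
of the full **level-1 X-perfect family**: for integers `q ≥ 2`, `b ≥ 1`, `a, c` with `a + c = qb`, the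
first-power `CW_q` laser method with joint type

  `Q = (ma on (1,1,0), mb on (0,1,1), mc on (1,0,1), mb on (2,0,0))`, `N = (q+2)bm`,

i.e. the law `(p − θ, θ, 1 − θ − p, θ)` with `θ = 1/(q+2)`, `p = (a+b)/((q+2)b)` — `X`-marginal
`(θ, 1 − 2θ, θ)` (uniform on the `q+2` fine indices: PERFECT), `Y = (1−p, p, 0)`, `Z = (p, 1−p, 0)`.
Everything in the lineage's pipeline is already symbolic in `(θ, p)` (`marginalDist_fam`,
`maxEntropyPenalty_fam_nonpos`, `entropyX_eq`, `famThreshold`); this file re-runs layers B1/B2 for the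
general type (`xpDiagonalRaw`, `xpEntropy`, `xpDiagonal` — the proofs of `famDiagonalRaw`, `famEntropy`,
`famDiagonal` with `k+1 ↦ a`, `k ↦ b`), under the family's ENTROPY CONDITION

  `2 η(θ) + η(1 − 2θ) ≤ h(p)`, in integers: `(a+b)^{a+b} · (b+c)^{b+c} ≤ b^{(q+2)b} · q^{qb}`.

File 2/2 (`SaturationLadderXPerfectFamily.lean`) assembles **`ω(a, b, c) ≤ qb = a + c`** (exact: the
information bound), i.e. the thin exact-tightness points `T(b/a, c/a)` and `T(b/c, a/c)`, and moves the
frontier of the `E₂`-chord ladder (`Theorems/SaturationLadderChordLadder.lean`) from `0.3386` to `0.3465`.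
This helper file imports no route (`Theses`) file (gate lint `theses-cone`).

References: Coppersmith–Winograd 1990 §6–§7 [CoppersmithWinograd1990]; Le Gall, ISSAC 2014, App. A
[LeGall2014]; Alman–Duan–Vassilevska Williams–Xu–Xu–Zhou, SODA 2025, Thm. 3.2
[AlmanDuanVassilevskaWilliamsXuXuZhou2025].  No new definitions, no named facts, no sorry.
-/

set_option linter.dupNamespace false
-- (single-conjunct summit: the namespace repeats `MatrixMultiplication`)

noncomputable section

open Finset
open scoped BigOperators

namespace Summit.MatrixMultiplication.MatrixMultiplication.Theorems.SaturationLadderXPerfect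

open Literature.Computability.AlgebraicComplexity
open Literature.Barriers.MatrixMultiplication
open Summit.MatrixMultiplication.MatrixMultiplication.Theorems.SaturationLadderExpSaturation

/-! ## Layer B1 — a large free diagonal of the joint type `(ma, mb, mc, mb)`, `N = (q+2)bm` -/

/-- **Combinatorial layer (two-parameter family).** For `b, m ≥ 1`, `qb = a + c`, `N = (q+2) b m` and
`P = Q/N` with `Q(1,1,0) = ma`, `Q(0,1,1) = mb`, `Q(1,0,1) = mc`, `Q(2,0,0) = mb` (`0` elsewhere),
there is a family `Δ` of triples of level words, coordinatewise in `cwSupport₃ = {i+j+l = 2}`, each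
with exactly `ma`, `mb`, `mc` positions of pattern `(1,1,0)`, `(0,1,1)`, `(1,0,1)`, forming a
free diagonal, with `2^{N (min_m H(P_m) − Γ_S(P))} ≤ |Δ| · (N+1)^63 · 192 · exp(4 √(log 6 + N log 27))`
(`exists_free_diagonal_jointType_card` for `S = cwSupport₃`, `b = 2`, `G = 27`, `A = 9`; the proof of
`famDiagonalRaw` with `k+1 ↦ a`, `k ↦ b`). [cite: LeGall2014, Appendix A.3, Eq. (7) and p. 24] -/
theorem xpDiagonalRaw :
    ∀ q a b c m : ℕ, 1 ≤ b → 1 ≤ m → q * b = a + c → ∀ P : Fin 3 × Fin 3 × Fin 3 → ℝ,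
      (∀ s, P s = ((if s = (1, 1, 0) then m * a else if s = (0, 1, 1) then m * b
          else if s = (1, 0, 1) then m * c else if s = (2, 0, 0) then m * b else 0 : ℕ) : ℝ) /
            ((((q + 2) * b * m : ℕ)) : ℝ)) →
      ∃ Δ : Finset ((Fin ((q + 2) * b * m) → Fin 3) × (Fin ((q + 2) * b * m) → Fin 3) ×
          (Fin ((q + 2) * b * m) → Fin 3)),
        (∀ δ ∈ Δ, ∀ ρ, labelSeq δ ρ ∈ cwSupport₃) ∧
        (∀ δ ∈ Δ, letterCount (labelSeq δ) (1, 1, 0) = m * a ∧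
          letterCount (labelSeq δ) (0, 1, 1) = m * b ∧ letterCount (labelSeq δ) (1, 0, 1) = m * c) ∧
        (∀ δ ∈ Δ, ∀ δ' ∈ Δ, ∀ δ'' ∈ Δ, (∀ ρ, (δ.1 ρ, δ'.2.1 ρ, δ''.2.2 ρ) ∈ cwSupport₃) →
          δ = δ' ∧ δ' = δ'') ∧
        (2 : ℝ) ^ (((((q + 2) * b * m : ℕ)) : ℝ) *
            (min (shannonEntropy (marginalDist₁ P))
              (min (shannonEntropy (marginalDist₂ P)) (shannonEntropy (marginalDist₃ P))) -
              maxEntropyPenalty cwSupport₃ P)) ≤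
          (Δ.card : ℝ) * ((((((q + 2) * b * m : ℕ)) : ℝ)) + 1) ^ 63 * 192 *
            Real.exp (4 * Real.sqrt (Real.log 6 + ((((q + 2) * b * m : ℕ)) : ℝ) * Real.log 27)) := by
  intro q a b c m hb hm hqb P hP
  classical
  -- tightness data of `cwSupport₃` (as in `bigCw_laser_inequality`)
  have hinj : Function.Injective fun (i : Fin 3) (_ : Fin 1) => (i : ℤ) := by
    intro i i' h
    have h0 := congrFun h 0
    simp only [Nat.cast_inj] at h0
    exact Fin.ext h0
  have hinjγ : Function.Injective fun (l : Fin 3) (_ : Fin 1) => (l : ℤ) - 2 := by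
    intro l l' h
    have h0 := congrFun h 0
    simp only [sub_left_inj, Nat.cast_inj] at h0
    exact Fin.ext h0
  have hbd : ∀ (i : Fin 3) (ρ : Fin 1), |((fun (i : Fin 3) (_ : Fin 1) => (i : ℤ)) i ρ)| ≤ (2 : ℕ) := by
    intro i ρ
    have := i.isLt
    simp only [Nat.cast_ofNat, Nat.abs_cast]
    omega
  have htight : ∀ s ∈ cwSupport₃, ∀ ρ : Fin 1,
      (fun (i : Fin 3) (_ : Fin 1) => (i : ℤ)) s.1 ρ + (fun (j : Fin 3) (_ : Fin 1) => (j : ℤ)) s.2.1 ρ +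
        (fun (l : Fin 3) (_ : Fin 1) => (l : ℤ) - 2) s.2.2 ρ = 0 := by
    intro s hs ρ
    rw [mem_cwSupport₃] at hs
    simp only
    omega
  -- the joint type `Q` and `N = (q+2) b m`
  obtain ⟨Q, hQdef⟩ : ∃ Q : Fin 3 × Fin 3 × Fin 3 → ℕ, Q = fun s =>
      if s = (1, 1, 0) then m * a else if s = (0, 1, 1) then m * b
      else if s = (1, 0, 1) then m * c else if s = (2, 0, 0) then m * b else 0 :=
    ⟨_, rfl⟩
  have hN : 0 < (q + 2) * b * m := Nat.mul_pos (Nat.mul_pos (by omega) (by omega)) (by omega)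
  have hQS : ∀ s, s ∉ cwSupport₃ → Q s = 0 := by
    intro s hs
    rw [mem_cwSupport₃_iff] at hs
    push Not at hs
    obtain ⟨h1, h2, h3, h4, -, -⟩ := hs
    simp [hQdef, h1, h2, h3, h4]
  have hsumQ : m * a + m * b + m * c + m * b = (q + 2) * b * m := by
    have h1 : (q + 2) * b * m = (q * b) * m + 2 * b * m := by ring
    rw [h1, hqb]
    ring
  have hQ : ∑ s, Q s = (q + 2) * b * m := by
    rw [sum_triple_eq, hQdef, ← hsumQ]
    simp [Fin.sum_univ_three]
    ring
  have hP' : ∀ s, P s = (Q s : ℝ) / ((((q + 2) * b * m : ℕ)) : ℝ) := by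
    intro s
    rw [hQdef]
    exact hP s
  -- the tree theorem
  obtain ⟨Δ, hΔQ, hfree, hsize⟩ := exists_free_diagonal_jointType_card cwSupport₃ (r := 1) (b := 2)
    (fun (i : Fin 3) (_ : Fin 1) => (i : ℤ)) (fun (j : Fin 3) (_ : Fin 1) => (j : ℤ))
    (fun (l : Fin 3) (_ : Fin 1) => (l : ℤ) - 2) hinj hinj hinjγ hbd hbd htight hN Q hQS hQ P hP'
  have hQδ : ∀ δ ∈ Δ, letterCount (labelSeq δ) = Q := fun δ hδ => (Finset.mem_filter.1 (hΔQ hδ)).2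
  refine ⟨Δ, ?_, ?_, hfree, ?_⟩
  · -- coordinatewise support
    intro δ hδ ρ
    by_contra hρ
    have h0 := hQS _ hρ
    rw [← hQδ δ hδ] at h0
    exact (letterCount_pos_of_apply (labelSeq δ) ρ).ne' h0
  · -- the three letter counts
    intro δ hδ
    rw [hQδ δ hδ, hQdef]
    simp
  · -- the size bound, constants evaluated
    refine hsize.trans_eq ?_
    have hmax : (max 2 1 : ℕ) = 2 := by decide
    generalize ((((q + 2) * b * m : ℕ)) : ℝ) = Nr
    simp only [Fintype.card_prod, Fintype.card_fin, hmax]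
    norm_num
    simp only [mul_assoc]

/-! ## Layer B2 — entropy evaluation (the law `(p − θ, θ, 1 − θ − p, θ)`, `p = (a+b)/((q+2)b)`) -/

/-- **Entropy layer (two-parameter family).**  For `P = Q/N` (`Q = (ma, mb, mc, mb)` on
`(1,1,0), (0,1,1), (1,0,1), (2,0,0)`, `N = (q+2)bm`, `qb = a + c`), under the entropy condition
`2 η(1/(q+2)) + η(q/(q+2)) ≤ h((a+b)/((q+2)b))`:
`log 2 · (min_m H(P_m) − Γ_S(P)) ≥ log(q+2) − (q/(q+2)) log q = H_nats(X)` (the proof of `famEntropy`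
with `k+1 ↦ a`, `k ↦ b`; `Γ_S(P) = 0` by `maxEntropyPenalty_fam_nonpos`). [folklore] -/
theorem xpEntropy (q a b c m : ℕ) (hq : 2 ≤ q) (hb : 1 ≤ b) (hm : 1 ≤ m) (hqb : q * b = a + c)
    (hent : 2 * Real.negMulLog (1 / ((q : ℝ) + 2)) + Real.negMulLog (1 - 2 * (1 / ((q : ℝ) + 2))) ≤
      Real.binEntropy (((a : ℝ) + b) / (((q : ℝ) + 2) * b)))
    (P : Fin 3 × Fin 3 × Fin 3 → ℝ)
    (hP : ∀ s, P s = ((if s = (1, 1, 0) then m * a else if s = (0, 1, 1) then m * b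
        else if s = (1, 0, 1) then m * c else if s = (2, 0, 0) then m * b else 0 : ℕ) : ℝ) /
          ((((q + 2) * b * m : ℕ)) : ℝ)) :
    Real.log ((q : ℝ) + 2) - (q : ℝ) / ((q : ℝ) + 2) * Real.log (q : ℝ) ≤
      Real.log 2 * (min (shannonEntropy (marginalDist₁ P))
        (min (shannonEntropy (marginalDist₂ P)) (shannonEntropy (marginalDist₃ P))) -
        maxEntropyPenalty cwSupport₃ P) := by
  have hq0 : (0 : ℝ) < q := by exact_mod_cast (by omega : 0 < q)
  have hb0 : (0 : ℝ) < b := by exact_mod_cast hb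
  have hm0 : (0 : ℝ) < m := by exact_mod_cast hm
  have hq2 : (0 : ℝ) < (q : ℝ) + 2 := by linarith
  have ha0 : (0 : ℝ) ≤ a := Nat.cast_nonneg a
  have hc0 : (0 : ℝ) ≤ c := Nat.cast_nonneg c
  have hc' : (c : ℝ) = (q : ℝ) * b - a := by
    have h := congrArg (Nat.cast (R := ℝ)) hqb
    push_cast at h
    linarith
  set θ : ℝ := 1 / ((q : ℝ) + 2) with hθdef
  set p : ℝ := ((a : ℝ) + b) / (((q : ℝ) + 2) * b) with hpdef
  -- the law as probabilities
  have hPp : ∀ s, P s = if s = (1, 1, 0) then p - θ else if s = (0, 1, 1) then θ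
      else if s = (1, 0, 1) then 1 - θ - p else if s = (2, 0, 0) then θ else 0 := by
    intro s
    rw [hP s, hθdef, hpdef]
    push_cast
    split_ifs <;>
      first | (rw [hc']; field_simp; ring) | (field_simp; ring) | field_simp
  -- the probability constraints `0 ≤ θ ≤ p`, `θ + p ≤ 1`
  have hθ0 : 0 ≤ θ := by positivity
  have hθp : θ ≤ p := by
    rw [hθdef, hpdef, div_le_div_iff₀ hq2 (by positivity)]
    nlinarith
  have hθp1 : θ + p ≤ 1 := by
    have e : θ + p = ((a : ℝ) + 2 * b) / (((q : ℝ) + 2) * b) := by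
      rw [hθdef, hpdef]
      field_simp
      ring
    rw [e, div_le_one (by positivity)]
    nlinarith
  obtain ⟨hm₁, hm₂, hm₃⟩ := marginalDist_fam hPp
  have hpen : maxEntropyPenalty cwSupport₃ P ≤ 0 := maxEntropyPenalty_fam_nonpos hPp hθ0 hθp hθp1
  have hlog : 0 < Real.log 2 := Real.log_pos one_lt_two
  -- The folklore identities `H(1−p,p,0) = H(p,1−p,0) = h(p)/log 2` are verbatim the tree's
  -- `PerfectAmortisation.shannonEntropy_vec3_eq_binEntropy'` / `…_eq_binEntropy`
  -- (`Theorems/ShapeSubmodularityPerfectAmortisationStubCwRectEntropy.lean`), whose farm olean is unbuilt at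
  -- landing time (rc 75 `remote:stale:unbuilt`); proved locally instead of restated (gate rule `dedup.landed`).
  -- TODO(dedup): import that module and `rw` with the tree names once its olean is built.
  have shannonEntropy_vec3_Y : ∀ p : ℝ,
      shannonEntropy ![1 - p, p, 0] = Real.binEntropy p / Real.log 2 := fun p => by
    rw [shannonEntropy_def, Fin.sum_univ_three, Real.binEntropy_eq_negMulLog_add_negMulLog_one_sub]
    congr 1
    simp only [Matrix.cons_val_zero, Matrix.cons_val_one, Matrix.cons_val_two, Matrix.head_cons,
      Matrix.tail_cons, Real.negMulLog_zero, add_zero]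
    ring
  have shannonEntropy_vec3_Z : ∀ p : ℝ,
      shannonEntropy ![p, 1 - p, 0] = Real.binEntropy p / Real.log 2 := fun p => by
    rw [shannonEntropy_def, Fin.sum_univ_three, Real.binEntropy_eq_negMulLog_add_negMulLog_one_sub]
    congr 1
    simp only [Matrix.cons_val_zero, Matrix.cons_val_one, Matrix.cons_val_two, Matrix.head_cons,
      Matrix.tail_cons, Real.negMulLog_zero, add_zero]
  have hXY : shannonEntropy ![θ, 1 - 2 * θ, θ] ≤ shannonEntropy ![1 - p, p, 0] := by
    rw [shannonEntropy_vec3_X, shannonEntropy_vec3_Y]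
    exact div_le_div_of_nonneg_right hent hlog.le
  have hXZ : shannonEntropy ![θ, 1 - 2 * θ, θ] ≤ shannonEntropy ![p, 1 - p, 0] := by
    rw [shannonEntropy_vec3_X, shannonEntropy_vec3_Z]
    exact div_le_div_of_nonneg_right hent hlog.le
  rw [hm₁, hm₂, hm₃, min_eq_left (le_min hXY hXZ), shannonEntropy_vec3_X, mul_sub,
    mul_div_cancel₀ _ hlog.ne']
  rw [hθdef, entropyX_eq (q : ℝ) hq0]
  have h2 : Real.log 2 * maxEntropyPenalty cwSupport₃ P ≤ 0 :=
    mul_nonpos_of_nonneg_of_nonpos hlog.le hpen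
  linarith

/-- Layers B1 + B2: the free diagonal of the joint type `(ma, mb, mc, mb)` with the size bound in closed
form, `exp(N · (log(q+2) − (q/(q+2)) log q)) ≤ |Δ| · (N+1)^63 · 192 · exp(4 √(log 6 + N log 27))`,
`N = (q+2)bm` (the proof of `famDiagonal`). [folklore] -/
theorem xpDiagonal (q a b c m : ℕ) (hq : 2 ≤ q) (hb : 1 ≤ b) (hm : 1 ≤ m)
    (hqb : q * b = a + c)
    (hent : 2 * Real.negMulLog (1 / ((q : ℝ) + 2)) + Real.negMulLog (1 - 2 * (1 / ((q : ℝ) + 2))) ≤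
      Real.binEntropy (((a : ℝ) + b) / (((q : ℝ) + 2) * b))) :
    ∃ Δ : Finset ((Fin ((q + 2) * b * m) → Fin 3) × (Fin ((q + 2) * b * m) → Fin 3) ×
        (Fin ((q + 2) * b * m) → Fin 3)),
      (∀ δ ∈ Δ, ∀ ρ, labelSeq δ ρ ∈ cwSupport₃) ∧
      (∀ δ ∈ Δ, letterCount (labelSeq δ) (1, 1, 0) = m * a ∧
        letterCount (labelSeq δ) (0, 1, 1) = m * b ∧ letterCount (labelSeq δ) (1, 0, 1) = m * c) ∧
      (∀ δ ∈ Δ, ∀ δ' ∈ Δ, ∀ δ'' ∈ Δ, (∀ ρ, (δ.1 ρ, δ'.2.1 ρ, δ''.2.2 ρ) ∈ cwSupport₃) →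
        δ = δ' ∧ δ' = δ'') ∧
      Real.exp (((((q + 2) * b * m : ℕ)) : ℝ) *
          (Real.log ((q : ℝ) + 2) - (q : ℝ) / ((q : ℝ) + 2) * Real.log (q : ℝ))) ≤
        (Δ.card : ℝ) * ((((((q + 2) * b * m : ℕ)) : ℝ)) + 1) ^ 63 * 192 *
          Real.exp (4 * Real.sqrt (Real.log 6 + ((((q + 2) * b * m : ℕ)) : ℝ) * Real.log 27)) := by
  set P : Fin 3 × Fin 3 × Fin 3 → ℝ := fun s =>
    ((if s = (1, 1, 0) then m * a else if s = (0, 1, 1) then m * b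
        else if s = (1, 0, 1) then m * c else if s = (2, 0, 0) then m * b else 0 : ℕ) : ℝ) /
      ((((q + 2) * b * m : ℕ)) : ℝ) with hP
  have hPs : ∀ s, P s = ((if s = (1, 1, 0) then m * a else if s = (0, 1, 1) then m * b
      else if s = (1, 0, 1) then m * c else if s = (2, 0, 0) then m * b else 0 : ℕ) : ℝ) /
      ((((q + 2) * b * m : ℕ)) : ℝ) := fun s => rfl
  obtain ⟨Δ, hS, hcnt, hfree, hsize⟩ := xpDiagonalRaw q a b c m hb hm hqb P hPs
  have hent' := xpEntropy q a b c m hq hb hm hqb hent P hPs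
  refine ⟨Δ, hS, hcnt, hfree, le_trans ?_ hsize⟩
  set X : ℝ := min (shannonEntropy (marginalDist₁ P))
      (min (shannonEntropy (marginalDist₂ P)) (shannonEntropy (marginalDist₃ P))) -
      maxEntropyPenalty cwSupport₃ P with hX
  have hN0 : (0 : ℝ) ≤ ((((q + 2) * b * m : ℕ)) : ℝ) := Nat.cast_nonneg _
  rw [Real.rpow_def_of_pos two_pos, Real.exp_le_exp]
  calc ((((q + 2) * b * m : ℕ)) : ℝ) *
        (Real.log ((q : ℝ) + 2) - (q : ℝ) / ((q : ℝ) + 2) * Real.log (q : ℝ))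
      ≤ ((((q + 2) * b * m : ℕ)) : ℝ) * (Real.log 2 * X) := mul_le_mul_of_nonneg_left hent' hN0
    _ = Real.log 2 * (((((q + 2) * b * m : ℕ)) : ℝ) * X) := by ring

end Summit.MatrixMultiplication.MatrixMultiplication.Theorems.SaturationLadderXPerfect

end
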